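import Summits.QuantumFields.QCD.Theses.SmallBetaInfraredSplit
import Literature.MathematicalPhysics.QuantumLattice.StaggeredMasslessDeterminant
import Literature.MathematicalPhysics.QuantumLattice.TorusWilsonLinkTranslations
import Literature.MathematicalPhysics.QuantumFieldTheory.LatticeGaugeProofs

/-!
# Route `SmallBetaInfraredSplit` (sub QCD) — support item `TwoPointKernelStructure` (S0), PROVED

The β-independent structure of the gauge-level two-point kernel of the order field `ψ̄ψ` of
`U(N)` lattice gauge theory with massless staggered fermions on the even torus `(ℤ/Lℤ)^ν`,
`T_β(x,y) = ∫ Re det D₀[U] · Re W_{xy}(D₀[U]⁻¹) d(e^{-β S_W} Haar) / ∫ Re det D₀[U] d(e^{-β S_W} Haar)`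
(the determinant/propagator form of `ssTwoPoint`, Salmhofer–Seiler (2.10)–(2.12) with the
fermions integrated out), valid at EVERY real `β`:

* symmetry `T(x,y) = T(y,x)` — the Wick form `W_{xy}(G) = tr G_{xx} tr G_{yy} - tr(G_{xy}G_{yx})`
  is symmetric;
* translation invariance `T(x+t,y+t) = T(x,y)` — the change of variables
  `U(z,μ) ↦ η_μ(t)·U(z+t,μ)` on the link variables, where `η_μ(t) = ±1` is the staggered phase of
  the translation vector (a CENTRAL element of `U(N)`): it preserves the product Haar measure
  (edgewise left translation composed with a relabelling of the edges) and the Wilson action (the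
  central signs cancel plaquette by plaquette), hence the Wilson weight; and it carries the
  staggered operator to its reindexing by the site translation, `D₀[U'] = D₀[U] ∘ (τ_t × τ_t)`,
  because on an even torus `η_μ(z+t) = η_μ(z)η_μ(t)` — so `det D₀` is unchanged and the
  propagator contraction is translated;
* parity grading `T(x,y) = 0` for `ε(x) = ε(y)` — the tree's chiral selection rule
  `StrongCoupling.integral_det_re_mul_wick_re_eq_zero_of_sgn_eq` (numerator `0`).

This is glue of LINE 6 (ideator `ym-idea-2` g4) onto the LADDER-YM rung Q1 leaf
`SalmhoferSeilerSmallBeta` (label RECORD, QCD side).  Nothing about long-range order at `β > 0`,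
a mass gap, a continuum limit, or any summit is proved here.
[cite: SalmhoferSeiler1991, §2 (2.4), (2.8), (2.10)–(2.12); §3 (3.101)]
-/

set_option autoImplicit false

namespace Summit.QuantumFields.QCD.Theorems.SmallBetaInfraredSplit

open MeasureTheory Matrix Complex Finset
open Literature.MathematicalPhysics.QuantumFieldTheory
open Literature.MathematicalPhysics.QuantumLattice
open Literature.Probability.LatticeModels (TorusSite)

section Algebra

variable {ν L N : ℕ}

/-- On an even torus the staggered phase is multiplicative under translations:
`η_μ(x + t) = η_μ(x) η_μ(t)` (coordinate parities add when `2 ∣ L`).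
[cite: SalmhoferSeiler1991, §2 (2.4)] -/
theorem staggeredPhase_add_right [NeZero L] (hL : 2 ∣ L) (x t : TorusSite ν L) (μ : Fin ν) :
    staggeredPhase (x + t) μ = staggeredPhase x μ * staggeredPhase t μ := by
  have hmod : (∑ i ∈ Finset.univ.filter (· < μ), ((x + t) i).val) % 2 =
      ((∑ i ∈ Finset.univ.filter (· < μ), (x i).val) +
        ∑ i ∈ Finset.univ.filter (· < μ), (t i).val) % 2 := by
    rw [← Finset.sum_add_distrib, Finset.sum_nat_mod,
      Finset.sum_nat_mod _ 2 (fun i => (x i).val + (t i).val)]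
    congr 1
    refine Finset.sum_congr rfl fun i _ => ?_
    rw [Pi.add_apply, ZMod.val_add, Nat.mod_mod_of_dvd _ hL]
  unfold staggeredPhase
  rw [← uzpow_add]
  apply Additive.ofMul.injective
  rw [ofMul_uzpow, ofMul_uzpow, ← ZMod.natCast_smul_units, ← ZMod.natCast_smul_units,
    (ZMod.natCast_eq_natCast_iff' _ _ 2).mpr hmod]

/-- The forward neighbour of a translated site is the translated forward neighbour. [folklore] -/
theorem site_shift_add_right (x t : TorusSite ν L) (μ : Fin ν) :
    Site.shift (x + t) μ = Site.shift x μ + t := by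
  simp only [Site.shift, add_right_comm]

/-- A central sign `±1 ∈ U(N)` multiplies the defining representation by the scalar `±1`.
[folklore] -/
theorem rep_signMul (u : ℤˣ) (g : Matrix.unitaryGroup (Fin N) ℂ) :
    unitaryFundamentalRep (Fin N) ℂ
        ((if u = 1 then (1 : Matrix.unitaryGroup (Fin N) ℂ) else -1) * g) =
      ((u : ℤ) : ℂ) • unitaryFundamentalRep (Fin N) ℂ g := by
  rcases Int.units_eq_one_or u with rfl | rfl
  · simp
  · have h : (-1 : ℤˣ) ≠ 1 := by decide
    simp [h, Unitary.coe_neg]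

/-- The same for the group inverse: `ρ((±1·g)⁻¹) = (±1)·ρ(g⁻¹)`. [folklore] -/
theorem rep_signMul_inv (u : ℤˣ) (g : Matrix.unitaryGroup (Fin N) ℂ) :
    unitaryFundamentalRep (Fin N) ℂ
        ((if u = 1 then (1 : Matrix.unitaryGroup (Fin N) ℂ) else -1) * g)⁻¹ =
      ((u : ℤ) : ℂ) • unitaryFundamentalRep (Fin N) ℂ g⁻¹ := by
  rcases Int.units_eq_one_or u with rfl | rfl
  · simp
  · have h : (-1 : ℤˣ) ≠ 1 := by decide
    simp [h, inv_neg, Unitary.coe_neg]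

/-- **The staggered operator of the sign-corrected translated gauge field is the reindexed
staggered operator**: with `U'(z,μ) = η_μ(t)·U(z+t,μ)` and `τ_t(z,a) = (z+t,a)`,
`D_m[U'] = D_m[U] ∘ (τ_t × τ_t)` on an even torus (`η_μ(z+t) = η_μ(z)η_μ(t)`, `η_μ(t)² = 1`).
[cite: SalmhoferSeiler1991, §2 (2.3)–(2.4)] -/
theorem staggeredDirac_signShift [NeZero L] (hL : 2 ∣ L) (t : TorusSite ν L)
    (U : GaugeConfig ν L (Matrix.unitaryGroup (Fin N) ℂ)) (m : ℝ) :
    staggeredDirac (unitaryFundamentalRep (Fin N) ℂ)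
        (fun e => (if staggeredPhase t e.2 = 1 then (1 : Matrix.unitaryGroup (Fin N) ℂ) else -1) *
          U (e.1 + t, e.2)) m =
      (staggeredDirac (unitaryFundamentalRep (Fin N) ℂ) U m).submatrix
        ((Equiv.addRight t).prodCongr (Equiv.refl (Fin N)))
        ((Equiv.addRight t).prodCongr (Equiv.refl (Fin N))) := by
  ext p q
  simp only [Matrix.submatrix_apply, staggeredDirac, Matrix.of_apply]
  simp only [Equiv.prodCongr_apply, Prod.map_fst, Prod.map_snd, Equiv.coe_addRight,
    Equiv.coe_refl, id_eq]
  have hinj : Function.Injective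
      (Prod.map (fun x : TorusSite ν L => x + t) (id : Fin N → Fin N)) :=
    (add_left_injective t).prodMap Function.injective_id
  simp only [hinj.eq_iff]
  congr 1
  congr 1
  refine Finset.sum_congr rfl fun μ _ => ?_
  rw [staggeredPhase_add_right hL, Units.val_mul, Int.cast_mul]
  simp only [rep_signMul, rep_signMul_inv, Matrix.smul_apply, smul_eq_mul, site_shift_add_right,
    add_left_inj]
  split_ifs <;> ring

/-- Central signs depending only on the direction of the link drop out of every plaquette
holonomy. [folklore] -/
theorem plaquetteHolonomy_signMul (t : TorusSite ν L)
    (V : GaugeConfig ν L (Matrix.unitaryGroup (Fin N) ℂ)) (x : Site ν L) (i j : Fin ν) :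
    plaquetteHolonomy
        (fun e => (if staggeredPhase t e.2 = 1 then (1 : Matrix.unitaryGroup (Fin N) ℂ) else -1) *
          V e) x i j =
      plaquetteHolonomy V x i j := by
  have h : (-1 : ℤˣ) ≠ 1 := by decide
  unfold plaquetteHolonomy
  rcases Int.units_eq_one_or (staggeredPhase t i) with hi | hi <;>
    rcases Int.units_eq_one_or (staggeredPhase t j) with hj | hj <;>
    simp [hi, hj, h, inv_neg]

/-- Hence the Wilson action is invariant under the direction-dependent central signs. [folklore] -/
theorem wilsonAction_signMul [NeZero L] {M : ℕ}
    (ρ : Matrix.unitaryGroup (Fin N) ℂ →* Matrix (Fin M) (Fin M) ℂ) (t : TorusSite ν L)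
    (V : GaugeConfig ν L (Matrix.unitaryGroup (Fin N) ℂ)) :
    wilsonAction ρ
        (fun e => (if staggeredPhase t e.2 = 1 then (1 : Matrix.unitaryGroup (Fin N) ℂ) else -1) *
          V e) =
      wilsonAction ρ V := by
  simp only [wilsonAction, plaquetteHolonomy_signMul]

end Algebra

section MeasureInvariance

variable {ν L N : ℕ} [NeZero L]

/-- **The Wilson weight is invariant under the sign-corrected translation of the links**
`U(z,μ) ↦ η_μ(t)·U(z+t,μ)`: for every observable `F`,
`∫ F(U') d(e^{-βS_W} Haar^{⊗E})(U) = ∫ F(U) d(e^{-βS_W} Haar^{⊗E})(U)`.  The map is the edge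
relabelling `torusConfigShift (-t)` followed by the edgewise left translation by the central signs
(`exists_measurableEquiv_edgeTranslate`), both preserving product Haar measure, and it preserves
the Wilson action (`wilsonAction_signMul`, `wilsonAction_torusConfigShift`), hence the density
(`withDensity_map_of_measurableEquiv`). [folklore] -/
theorem integral_wilsonWeight_signShift {M : ℕ}
    (ρ : Matrix.unitaryGroup (Fin N) ℂ →* Matrix (Fin M) (Fin M) ℂ) (β : ℝ) (t : TorusSite ν L)
    (F : GaugeConfig ν L (Matrix.unitaryGroup (Fin N) ℂ) → ℝ) :
    ∫ U, F (fun e => (if staggeredPhase t e.2 = 1 then (1 : Matrix.unitaryGroup (Fin N) ℂ) else -1) *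
        U (e.1 + t, e.2)) ∂(wilsonWeight (d := ν) (L := L) ρ β) =
      ∫ U, F U ∂(wilsonWeight (d := ν) (L := L) ρ β) := by
  obtain ⟨T, hT, hTπ⟩ := exists_measurableEquiv_edgeTranslate (d := ν) (L := L)
    (G := Matrix.unitaryGroup (Fin N) ℂ)
    (fun e => if staggeredPhase t e.2 = 1 then (1 : Matrix.unitaryGroup (Fin N) ℂ) else -1) 1
  set Φ : GaugeConfig ν L (Matrix.unitaryGroup (Fin N) ℂ) ≃ᵐ
      GaugeConfig ν L (Matrix.unitaryGroup (Fin N) ℂ) :=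
    (torusConfigShift (G := Matrix.unitaryGroup (Fin N) ℂ) (-t)).trans T with hΦdef
  have hΦ : ∀ U : GaugeConfig ν L (Matrix.unitaryGroup (Fin N) ℂ),
      (Φ U : GaugeConfig ν L (Matrix.unitaryGroup (Fin N) ℂ)) =
        fun e => (if staggeredPhase t e.2 = 1 then (1 : Matrix.unitaryGroup (Fin N) ℂ) else -1) *
          U (e.1 + t, e.2) := by
    intro U
    funext e
    rw [hΦdef, MeasurableEquiv.coe_trans, Function.comp_apply, hT]
    simp only [torusConfigShift_apply, sub_neg_eq_add, Pi.one_apply, inv_one, mul_one]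
  have hshift : MeasurePreserving (torusConfigShift (G := Matrix.unitaryGroup (Fin N) ℂ) (-t))
      (Measure.pi fun _ : Edge ν L => haarProbability (Matrix.unitaryGroup (Fin N) ℂ))
      (Measure.pi fun _ : Edge ν L => haarProbability (Matrix.unitaryGroup (Fin N) ℂ)) :=
    measurePreserving_arrowCongr'
      (fun _ : Edge ν L => haarProbability (Matrix.unitaryGroup (Fin N) ℂ))
      (fun _ : Edge ν L => haarProbability (Matrix.unitaryGroup (Fin N) ℂ))
      (torusEdgeShift (-t)) (MeasurableEquiv.refl _) fun _ => MeasurePreserving.id _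
  have hπ : (Measure.pi fun _ : Edge ν L => haarProbability (Matrix.unitaryGroup (Fin N) ℂ)).map Φ =
      Measure.pi fun _ : Edge ν L => haarProbability (Matrix.unitaryGroup (Fin N) ℂ) :=
    (hshift.trans hTπ).map_eq
  have hS : ∀ U, wilsonAction ρ (Φ U) = wilsonAction ρ U := by
    intro U
    rw [hΦdef, MeasurableEquiv.coe_trans, Function.comp_apply, hT]
    simp only [Pi.one_apply, inv_one, mul_one]
    rw [wilsonAction_signMul, wilsonAction_torusConfigShift]
  have hW : (wilsonWeight (d := ν) (L := L) ρ β).map Φ = wilsonWeight (d := ν) (L := L) ρ β := by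
    unfold wilsonWeight
    exact withDensity_map_of_measurableEquiv _ Φ _ hπ (fun U => by rw [hS])
  have key : ∫ U, F (Φ U) ∂(wilsonWeight (d := ν) (L := L) ρ β) =
      ∫ U, F U ∂(wilsonWeight (d := ν) (L := L) ρ β) := by
    rw [← integral_map_equiv, hW]
  simpa only [hΦ] using key

end MeasureInvariance

/-- The route's support item `TwoPointKernelStructure` BY NAME: symmetry, translation invariance
and parity grading of the `m = 0` two-point kernel at every real `β`.
[cite: SalmhoferSeiler1991, §2 (2.10)–(2.12), §3 (3.101)] -/
theorem twoPointKernelStructure_proof :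
    Summit.QuantumFields.QCD.Theses.SmallBetaInfraredSplit.TwoPointKernelStructure := by
  intro N ν hN1 hν L _ hL β T
  haveI : NeZero ν := ⟨by omega⟩
  refine ⟨fun x y => ?_, fun t x y => ?_, fun x y hxy => ?_⟩
  · -- symmetry of the Wick form
    simp only [T]
    refine congrArg₂ (fun a b : ℝ => a / b) ?_ rfl
    refine integral_congr_ae (Filter.Eventually.of_forall fun U => ?_)
    refine congrArg₂ (fun a b : ℝ => a * b) rfl ?_
    refine congrArg Complex.re ?_
    rw [mul_comm, Finset.sum_comm]
    refine congrArg₂ (fun a b : ℂ => a - b) rfl ?_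
    refine Finset.sum_congr rfl fun a _ => Finset.sum_congr rfl fun b _ => ?_
    ring
  · -- translation invariance: change of variables `U(z,μ) ↦ η_μ(t)·U(z+t,μ)`
    simp only [T]
    refine congrArg₂ (fun a b : ℝ => a / b) ?_ rfl
    conv_rhs => rw [← integral_wilsonWeight_signShift (unitaryFundamentalRep (Fin N) ℂ) β t]
    refine integral_congr_ae (Filter.Eventually.of_forall fun U => ?_)
    dsimp only
    rw [staggeredDirac_signShift hL t U 0, Matrix.det_submatrix_equiv_self,
      Matrix.inv_submatrix_equiv]
    simp only [Matrix.submatrix_apply, Equiv.prodCongr_apply, Prod.map_apply, Equiv.coe_addRight,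
      Equiv.coe_refl, id_eq]
  · -- parity grading: the numerator vanishes
    simp only [T]
    rw [StrongCoupling.integral_det_re_mul_wick_re_eq_zero_of_sgn_eq hL _ hxy, zero_div]

end Summit.QuantumFields.QCD.Theorems.SmallBetaInfraredSplit
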